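import Summits.CriticalPhenomena.PercolationContinuityZ3.Theorems.PercNearOneGluingNoHeavyLowerTailSBTensKronDigits
import HarnessLib

/-!
# Scaled-Bernstein tensors IV: an expression language for one-line certificates
# (`NoHeavyLowerTail` cell, stmt-CriticalPhenomena-4575; prover `prim-hp-2`, gen 17)

Support file (`--supports stmt-CriticalPhenomena-4575`).  Computable definitions + soundness; no named facts, no sorries.
`…KNGoodGMgcCert*` wire the shape / leaf-bound / encoding bookkeeping of `…SBTens`, `…SBTensKron*` by hand for the specific products of
THEOREM B.  This file packages it once and for all: a polynomial inequality on `[0,1]ⁿ` whose terms are ±products of MULTI-AFFINE factors given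
by integer vertex functions `f : (ℕ → Bool) → ℤ` (= expectations of `f` over independent Bernoulli bits — world laws, pattern laws, cell tables)
is written as a `PE` expression, and
* `PE.reval n x e` is its real value (`vert m f ↦ SBTens.eval m (ofFn m f) x`, the Bernoulli expectation of `f` over the first `m` bits;
  `add/sub/mul/smul` pointwise);
* `PE.check n e` (list convolution, for small cases) and `PE.fastCheck B n e` (Kronecker packing with slot width `B`, e.g. `32`) are Booleans with
  `PE.nonneg_of_check` / **`PE.nonneg_of_fastCheck`** : `… = true → ∀ x ∈ [0,1]ⁿ, 0 ≤ PE.reval n x e`.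
So a new certificate is ONE definition and ONE `native_decide` (see the gen-17 memo §7 for the recipe and sizes: `4ⁿ⁺ᵈ…` coefficients; twelve
variables of degree three take ≈ 25 s packed).  Ingredients: `ofFnPad` (vertex tensor in the first `m` of `n` variables), `maxAbs` (leaf bound of a
small tensor), and the structural invariant `PE.spec` (shape, value, leaf bound, encoding).
-/

namespace Summit.CriticalPhenomena.PercolationContinuityZ3.Theorems

namespace SBTens

/-! ## Padded vertex tensors and leaf maxima -/

/-- The multi-affine tensor of `f` in the first `m` variables, of degree `0` in the variables `m, …, n-1`. [folklore] -/
def ofFnPad (m : ℕ) : (n : ℕ) → ((ℕ → Bool) → ℤ) → Tens n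
  | 0, f => ofInt (f fun _ => false)
  | n + 1, f =>
    if n < m then ofList [ofFnPad m n (fun c => f (Function.update c n false)), ofFnPad m n (fun c => f (Function.update c n true))]
    else ofList [ofFnPad m n f]

/-- Shape of `ofFnPad m n`: degree `1` below `m`, `0` from `m` on (outermost first). [folklore] -/
def shapePad (m : ℕ) : ℕ → List ℕ
  | 0 => []
  | n + 1 => (if n < m then 1 else 0) :: shapePad m n

/-- Length of `shapePad`. [folklore] -/
theorem length_shapePad (m : ℕ) : ∀ n, (shapePad m n).length = n
  | 0 => rfl
  | n + 1 => by simp [shapePad, length_shapePad m n]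

/-- `ofFnPad` is well formed of shape `shapePad`. [folklore] -/
theorem WF_ofFnPad (m : ℕ) : ∀ (n : ℕ) (f : (ℕ → Bool) → ℤ), WF n (shapePad m n) (ofFnPad m n f)
  | 0, f => (WF_zero _ _).2 rfl
  | n + 1, f => by
    unfold ofFnPad shapePad
    split_ifs with h
    · exact (WF_succ _ _ _ _).2 ⟨rfl, fun a ha => by
        simp only [toList_ofList, List.mem_cons, List.not_mem_nil, or_false] at ha
        rcases ha with rfl | rfl <;> exact WF_ofFnPad m n _⟩
    · exact (WF_succ _ _ _ _).2 ⟨rfl, fun a ha => by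
        simp only [toList_ofList, List.mem_singleton] at ha; subst ha; exact WF_ofFnPad m n f⟩

/-- Below `m` the padded tensor is the plain vertex tensor. [folklore] -/
theorem ofFnPad_eq_ofFn (m : ℕ) : ∀ (n : ℕ) (f : (ℕ → Bool) → ℤ), n ≤ m → ofFnPad m n f = ofFn n f
  | 0, f, _ => rfl
  | n + 1, f, h => by
    have hn : n < m := h
    unfold ofFnPad
    rw [if_pos hn, ofFnPad_eq_ofFn m n _ (le_of_lt hn), ofFnPad_eq_ofFn m n _ (le_of_lt hn)]
    rfl

/-- Value of the padded tensor: the expectation over the first `m` bits. [folklore] -/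
theorem eval_ofFnPad (m : ℕ) : ∀ (n : ℕ) (f : (ℕ → Bool) → ℤ) (x : ℕ → ℝ), m ≤ n → eval n (ofFnPad m n f) x = eval m (ofFn m f) x
  | 0, f, x, h => by have : m = 0 := Nat.le_zero.1 h; subst this; rfl
  | n + 1, f, x, h => by
    by_cases hn : n < m
    · have hm : m = n + 1 := le_antisymm h hn
      subst hm
      rw [ofFnPad_eq_ofFn (n + 1) (n + 1) f le_rfl]
    · have hmn : m ≤ n := Nat.le_of_not_lt hn
      have : ofFnPad m (n + 1) f = lift (ofFnPad m n f) := by rw [ofFnPad, if_neg hn]; rfl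
      rw [this, eval_lift, eval_ofFnPad m n f x hmn]

/-- The largest absolute value of a leaf. [folklore] -/
def maxAbs : (n : ℕ) → Tens n → ℕ
  | 0, a => (toInt a).natAbs
  | n + 1, L => (toList L).foldr (fun c acc => max (maxAbs n c) acc) 0

/-- Each element is below the folded maximum. [folklore] -/
theorem le_foldr_max {α : Type} (g : α → ℕ) : ∀ (L : List α) (c : α), c ∈ L → g c ≤ L.foldr (fun c acc => max (g c) acc) 0
  | [], c, hc => by simp at hc
  | d :: L, c, hc => by
    rw [List.foldr_cons]
    rcases List.mem_cons.1 hc with rfl | hc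
    · exact le_max_left _ _
    · exact (le_foldr_max g L c hc).trans (le_max_right _ _)

/-- Every leaf is bounded by `maxAbs`. [folklore] -/
theorem bnd_maxAbs : ∀ (n : ℕ) (T : Tens n), bnd (maxAbs n T) n T
  | 0, _ => (bnd_zero _ _).2 le_rfl
  | n + 1, L => (bnd_succ _ _ _).2 fun c hc =>
      bnd_mono n _ _ c (le_foldr_max (maxAbs n) (toList L) c hc) (bnd_maxAbs n c)

/-! ## Expressions -/

/-- Polynomial expressions: ±products of padded vertex tensors (`vert m f` = the multi-affine polynomial with vertex values `f` in the first
`m` variables). [folklore] -/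
inductive PE : Type where
  | vert (m : ℕ) (f : (ℕ → Bool) → ℤ) : PE
  | add (a b : PE) : PE
  | sub (a b : PE) : PE
  | mul (a b : PE) : PE
  | smul (k : ℤ) (a : PE) : PE

namespace PE

/-- Shape (degrees, outermost first) in `n` variables. [folklore] -/
def shape (n : ℕ) : PE → List ℕ
  | vert m _ => shapePad m n
  | add a _ => a.shape n
  | sub a _ => a.shape n
  | mul a b => List.zipWith (· + ·) (a.shape n) (b.shape n)
  | smul _ a => a.shape n

/-- Structural consistency (sums of equal shapes, factors within `n` variables). [folklore] -/
def ok (n : ℕ) : PE → Bool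
  | vert m _ => decide (m ≤ n)
  | add a b => a.ok n && b.ok n && (a.shape n == b.shape n)
  | sub a b => a.ok n && b.ok n && (a.shape n == b.shape n)
  | mul a b => a.ok n && b.ok n
  | smul _ a => a.ok n

/-- The tensor (list convolutions; only `check` materialises it). [folklore] -/
def tens (n : ℕ) : PE → Tens n
  | vert m f => ofFnPad m n f
  | add a b => SBTens.add n (a.tens n) (b.tens n)
  | sub a b => SBTens.sub n (a.tens n) (b.tens n)
  | mul a b => SBTens.mul n (a.tens n) (b.tens n)
  | smul k a => SBTens.smul n k (a.tens n)

/-- The real value: `vert m f ↦` the Bernoulli expectation of `f` over the first `m` bits; operations pointwise. [folklore] -/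
noncomputable def reval (n : ℕ) (x : ℕ → ℝ) : PE → ℝ
  | vert m f => SBTens.eval m (ofFn m f) x
  | add a b => a.reval n x + b.reval n x
  | sub a b => a.reval n x - b.reval n x
  | mul a b => a.reval n x * b.reval n x
  | smul k a => (k : ℝ) * a.reval n x

/-- A-priori leaf bound of the tensor. [folklore] -/
def bound (n : ℕ) : PE → ℕ
  | vert m f => maxAbs n (ofFnPad m n f)
  | add a b => a.bound n + b.bound n
  | sub a b => a.bound n + b.bound n
  | mul a b => a.bound n * b.bound n * lenProd (a.shape n)
  | smul k a => k.natAbs * a.bound n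

/-- Kronecker encoding computed through the factors (big-integer arithmetic only). [folklore] -/
def enc (B n : ℕ) : PE → ℤ
  | vert m f => ienc B n (ofFnPad m n f)
  | add a b => a.enc B n + b.enc B n
  | sub a b => a.enc B n - b.enc B n
  | mul a b => a.enc B n * b.enc B n
  | smul k a => k * a.enc B n

/-- **Structural invariant**: for a consistent expression the tensor has the declared shape, evaluates to `reval`, has leaves bounded by
`bound`, and encodes to `enc`. [folklore] -/
theorem spec (n : ℕ) : ∀ e : PE, e.ok n = true →
    WF n (e.shape n) (e.tens n) ∧ (e.shape n).length = n ∧ (∀ x, SBTens.eval n (e.tens n) x = e.reval n x) ∧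
      bnd (e.bound n) n (e.tens n) ∧ ∀ B, ienc B n (e.tens n) = e.enc B n
  | vert m f, h => by
    have hm : m ≤ n := by simpa [ok] using h
    exact ⟨WF_ofFnPad m n f, length_shapePad m n, fun x => eval_ofFnPad m n f x hm, bnd_maxAbs n _, fun B => rfl⟩
  | add a b, h => by
    simp only [ok, Bool.and_eq_true, beq_iff_eq] at h
    obtain ⟨⟨ha, hb⟩, hs⟩ := h
    obtain ⟨wa, la, ea, ba, ia⟩ := spec n a ha
    obtain ⟨wb, -, eb, bb, ib⟩ := spec n b hb
    rw [← hs] at wb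
    refine ⟨(add_spec n _ _ _ wa wb).1, la, fun x => ?_, bnd_add n _ _ _ _ ba bb, fun B => ?_⟩
    · simp only [tens, reval, (add_spec n _ _ _ wa wb).2 x, ea, eb]
    · simp only [tens, enc, ienc_add B n _ _ _ wa wb, ia, ib]
  | sub a b, h => by
    simp only [ok, Bool.and_eq_true, beq_iff_eq] at h
    obtain ⟨⟨ha, hb⟩, hs⟩ := h
    obtain ⟨wa, la, ea, ba, ia⟩ := spec n a ha
    obtain ⟨wb, -, eb, bb, ib⟩ := spec n b hb
    rw [← hs] at wb
    refine ⟨(sub_spec n _ _ _ wa wb).1, la, fun x => ?_, bnd_sub n _ _ _ _ ba bb, fun B => ?_⟩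
    · simp only [tens, reval, (sub_spec n _ _ _ wa wb).2 x, ea, eb]
    · simp only [tens, enc, ienc_sub B n _ _ _ wa wb, ia, ib]
  | mul a b, h => by
    simp only [ok, Bool.and_eq_true] at h
    obtain ⟨ha, hb⟩ := h
    obtain ⟨wa, la, ea, ba, ia⟩ := spec n a ha
    obtain ⟨wb, lb, eb, bb, ib⟩ := spec n b hb
    have hm := mul_spec n _ _ _ _ la lb wa wb
    refine ⟨hm.1, by simp [shape, List.length_zipWith, la, lb], fun x => ?_, bnd_mul n _ _ _ _ _ wa ba bb, fun B => ?_⟩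
    · simp only [tens, reval, hm.2 x, ea, eb]
    · simp only [tens, enc, ienc_mul B n _ _ _ _ la lb wa wb, ia, ib]
  | smul k a, h => by
    simp only [ok] at h
    obtain ⟨wa, la, ea, ba, ia⟩ := spec n a h
    have hs := smul_spec n _ k _ wa
    refine ⟨hs.1, la, fun x => ?_, bnd_smul n _ k _ ba, fun B => ?_⟩
    · simp only [tens, reval, hs.2 x, ea]
    · simp only [tens, enc, ienc_smul B n _ k _ wa, ia]

/-- The plain check: consistent and all scaled-Bernstein coefficients `≥ 0` (list convolution). [folklore] -/
def check (n : ℕ) (e : PE) : Bool := e.ok n && allNonneg n (e.tens n)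

/-- **Plain certificate**: `check ⇒ reval ≥ 0` on `[0,1]ⁿ`. [folklore] -/
theorem nonneg_of_check (n : ℕ) (e : PE) (h : e.check n = true) (x : ℕ → ℝ) (hx : ∀ i, 0 ≤ x i ∧ x i ≤ 1) :
    0 ≤ e.reval n x := by
  simp only [check, Bool.and_eq_true] at h
  obtain ⟨hok, hnn⟩ := h
  rw [← ((spec n e hok).2.2.1 x)]
  exact eval_nonneg n _ x hx hnn

/-- The packed check with slot width `B`: consistent, degrees `≤ 3`, leaf bound `< 2^(B-1)`, digit test on the packed encoding. [folklore] -/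
def fastCheck (B n : ℕ) (e : PE) : Bool :=
  e.ok n && ((e.shape n).all fun d => decide (d ≤ 3)) && decide (1 ≤ B) && decide ((e.bound n : ℤ) + 1 ≤ 2 ^ (B - 1)) &&
    dec B n (e.enc B n + off B n).toNat

/-- **Packed certificate**: `fastCheck ⇒ reval ≥ 0` on `[0,1]ⁿ`. [folklore] -/
theorem nonneg_of_fastCheck (B n : ℕ) (e : PE) (h : e.fastCheck B n = true) (x : ℕ → ℝ) (hx : ∀ i, 0 ≤ x i ∧ x i ≤ 1) :
    0 ≤ e.reval n x := by
  simp only [fastCheck, Bool.and_eq_true, List.all_eq_true, decide_eq_true_eq] at h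
  obtain ⟨⟨⟨⟨hok, hds⟩, hB⟩, hR⟩, hdec⟩ := h
  obtain ⟨w, -, ev, bd, ie⟩ := spec n e hok
  rw [← ie B] at hdec
  have hnn := dec_sound B (e.bound n) hB hR n (e.shape n) (e.tens n) w (fun d hd => hds d hd) bd hdec
  rw [← ev x]
  exact eval_nonneg n _ x hx hnn

end PE

end SBTens

end Summit.CriticalPhenomena.PercolationContinuityZ3.Theorems
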